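import Literature.NumberTheory.GelbartRogawski1991.DoubledWeilRepresentationArchHalfExplicit
import Literature.NumberTheory.Weil1964.ArchMetaplecticSubgroup
import Literature.NumberTheory.Weil1964.ArchFollandTorusKType
import HarnessLib

/-!
# The archimedean half of the `χ`-normalised doubled Weil representation on the doubled archimedean GAUSSIAN
# ([Folland1989, Prop. (4.39)]: `ν(P)` fixes the Gaussian up to `det^{-1/2}`; [Paul1998, (1.2.1)–(1.2.2)])

Topic `NumberTheory/GelbartRogawski1991`; namespaces `Literature.NumberTheory.Weil1964` (§1) and `…GelbartRogawski1991.GRConstruction` (§2).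
KERNEL ONLY: proved theorems and two abbreviations (`frameD`, `sectionD` — the scaled Folland frame and Folland's section of the doubled group
exactly as in `exists_isArchHalf` ∕ `archWeilHalfD`); 0 records, 0 named facts, 0 `sorry`.  Sequel of `DoubledWeilRepresentationArchHalfExplicit`
(`archWeilHalfD`, `etaD`, `archHalfOf`, `doubledWeilRep_archToAdelic_eq_archHalfOf`, `vac_archWeilSectionS`).

* § 1 `Weil1964.omega_archLift_gaussian_tmul` (generic `archLift T e hT' j s hj hdict`): if the phase map of `s g` is UNITARY
  (`proj (s g) = realifySp u`) then `ω(archLift g)((e^*)⁻¹ k₀ ⊗ f) = vac (s g) • ((e^*)⁻¹ k₀ ⊗ f)` — `omega_archLift_tmul` + the tree's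
  `MpS.apply_hermitePi_zero_of_proj_eq_realifySp` (Schur against `μ₀(u)`, which fixes the Gaussian `k₀`).
* § 2 at the doubled CM datum: `omega_archWeilHalfD_gaussian_tmul` and **`omega_archHalfOf_gaussian_tmul`**: for `k ∈ H(L⁺ ⊗ ℝ)` with unitary
  phase map, `ω(archHalfOf t k)(G^𝔻 ⊗ f) = (η_t(k) · vac (sectionD k)) • (G^𝔻 ⊗ f)`, `G^𝔻 = follandHermite frameD 0` the Gaussian of the doubled
  frame.  With `doubledWeilRep_archToAdelic_eq_archHalfOf` (THE `χ`-normalised doubled Weil representation restricted to `H(L⁺ ⊗ ℝ)` IS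
  `archHalfOf t`) and `vac_archWeilSectionS` (`vac = (det d(G ⊗ 1))⁻¹` in the sign frames; `∏_v (det k⁻_v)⁻¹` on a sign-block compact `k`) this is
  the `K_H`-CHARACTER OF THE DOUBLED VACUUM under `sD_χ`: `λ(k) = ∏_v det(k_v)^{(t_{w(v)}+1)/2} · (det k⁻_v)⁻¹`, i.e. KK07's exponents
  `(a′, b′) = ((t_w + 1)/2, (t_w − 1)/2)` per place — step (KK) of the COR-CM X3-Char item (E) analytic residual.  NOT here: discharging the
  unitary-phase-map hypothesis for the sign-block compact elements of interest (`archPhaseMap_compact`), and the UNDOUBLING of the vacuum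
  (`omega_uD_tensorToSum`, the doubled Gaussian as `G ⊠ G`) to the pair Gaussian of the pin.

HC_CM is NOT proved here or anywhere in the tree.  References: G. B. Folland, *Harmonic Analysis in Phase Space* (1989), §4.2 Prop. (4.39)
[Folland1989]; A. Paul, J. Funct. Anal. 159 (1998), §1.2 (1.2.1)–(1.2.2) [Paul1998]; S. Gelbart, J. Rogawski, Invent. Math. 105 (1991), §3.1
Prop. 3.1.1 [GelbartRogawski1991]; K. Konno, T. Konno, Kyushu J. Math. 61 (2007), Lemma 5.2 [KonnoKonno2007].  Provenance: pub-hodgecm2 cell,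
seat item6-p3 (gen 11).
-/

set_option autoImplicit false

noncomputable section

open scoped Classical Matrix TensorProduct
open NumberField NumberField.InfinitePlace NumberField.mixedEmbedding
open Literature.NumberTheory.Automorphic Literature.NumberTheory.Automorphic.UnitaryGroup
open Literature.Analysis.SegalBargmann Literature.RepresentationTheory.HeisenbergGroup

namespace Literature.NumberTheory.Weil1964

open Literature.Analysis.SegalBargmann Literature.RepresentationTheory.HeisenbergGroup Literature.NumberTheory.Automorphic

/-! ## §1. A lifted section acts on the frame Gaussian ⊗ a finite vector by its vacuum coefficient, over unitary phase maps -/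

section LiftGaussian

variable {F : Type} [Field F] [NumberField F] {ι : Type} [Fintype ι] [DecidableEq ι]
  (T : Matrix ι ι (AdeleRing (𝓞 F) F)) {σ : Type*} [Fintype σ] [DecidableEq σ]
  (e : (ι → mixedSpace F) ≃L[ℝ] (σ → ℝ)) (hT' : IsUnit (archMat F ι T))
  {G : Type*} [Group G] (j : G →* symplecticGroup (polar (adelicForm F ι T))) (s : G →* MpS σ)
  (hj : ∀ (g : G) (k c : ι → IsDedekindDomain.FiniteAdeleRing (𝓞 F) F), (j g).1 (finVec k, finVec c) = (finVec k, finVec c))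
  (hdict : ∀ g : G, archPhaseMap T e hT' (j g) =
    ⇑((MpS.proj (s g)).1 : ((σ → ℝ) × (σ → ℝ)) ≃ₗ[ℝ] ((σ → ℝ) × (σ → ℝ))))

/-- **`ω(archLift g)` on the frame Gaussian**: if the phase map of `s g` is UNITARY (`proj (s g) = realifySp u`), then
`ω(archLift g)((e^*)⁻¹ k₀ ⊗ f) = vac (s g) • ((e^*)⁻¹ k₀ ⊗ f)` — the Gaussian `k₀ = h_0` of the frame is fixed up to the vacuum coefficient
([Folland1989, Prop. (4.39)]: `ν(P)` on the Gaussian; tree `MpS.apply_hermitePi_zero_of_proj_eq_realifySp`). [cite: Folland1989, §4.2 Prop. (4.39)] -/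
theorem omega_archLift_gaussian_tmul (g : G) (u : Matrix.unitaryGroup σ ℂ) (hu : MpS.proj (s g) = realifySp σ u)
    (f : FinSB F ι) :
    adelicMpCont.omega F ι T (archLift T e hT' j s hj hdict g)
        (piSchwartzBruhatEquiv F ι ((schwartzTransport e).symm (hermitePi 0) ⊗ₜ f)) =
      MpS.vac (s g) • piSchwartzBruhatEquiv F ι ((schwartzTransport e).symm (hermitePi 0) ⊗ₜ f) := by
  rw [omega_archLift_tmul, carrierConjEquiv_apply, ContinuousLinearEquiv.apply_symm_apply,
    MpS.apply_hermitePi_zero_of_proj_eq_realifySp hu, map_smul, ← TensorProduct.smul_tmul', map_smul]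

end LiftGaussian

end Literature.NumberTheory.Weil1964

namespace Literature.NumberTheory.GelbartRogawski1991.GRConstruction

open UnitaryDualPair UnitaryDualPair.ArchSplitting
open Literature.NumberTheory.Weil1964
open Literature.NumberTheory.GaloisRepresentations
open Literature.RepresentationTheory.HarrisKudlaSweet1996

variable (L : Type) [Field L] [NumberField L] [IsCMField L]

variable {N M n : ℕ} (e : Fin N × Fin M ≃ Fin n)
  (dV : Fin N → L) (hdV : ∀ i, IsCMField.complexConj L (dV i) = dV i) (hdV0 : ∀ i, dV i ≠ 0)
  (dW : Fin M → L) (hdW : ∀ i, IsCMField.complexConj L (dW i) = dW i) (hdW0 : ∀ i, dW i ≠ 0)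

/-- the scaled Folland frame of the doubled archimedean space in which `archHalfOf` is read (the frame of `exists_isArchHalf`).
[cite: GelbartRogawski1991, §3.1 Prop. 3.1.1 p. 455] -/
abbrev frameD : ((Fin (n + n)) → mixedSpace (Fp L)) ≃L[ℝ] ((Fin (n + n)) × {v : InfinitePlace (Fp L) // v.IsReal} → ℝ) :=
  scaledFrame (Fp L) (Fin (n + n))
    (placeScale (n + n) fun v => sqrtAbs (signVec (cmPlaceOver L)
      (fun k => Sum.elim (cmGramEntry L e dV hdV dW hdW) (-cmGramEntry L e dV hdV dW hdW) ((LocalSplitting.e₂ n).symm k))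
      (imagUnit L) v))
    (placeScale_ne_zero (n + n) (sqrtAbs_signVec_ne_zero (IsCMField.complexConj_ne_one L) (cmPlaceOver_smul L)
      (complexConj_imagUnit L) (imagUnit_ne_zero L) (gramD_gram_realDiagonal_entry_ne_zero L e dV hdV dW hdW hdV0 hdW0)))

/-- Folland's section of the doubled group in the `cmPlaceOver` sign frames (the `sW` of `exists_isArchHalf`). [cite: Paul1998, §1.2 (1.2.1) p. 389] -/
abbrev sectionD : UnitaryGroup.arch (Fp L) L (IsCMField.complexConj L) (n + n) (hermD L e dV hdV dW hdW) →*
    MpS (Fin (n + n) × {v : InfinitePlace (Fp L) // v.IsReal}) :=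
  archWeilSectionS L (IsCMField.complexConj L) (n + n) (IsCMField.complexConj_ne_one L) (cmPlaceOver L) (cmPlaceOver_smul L)
    (cmPlaceOver_comap L) _ (gramD_gram_realDiagonal_entry_ne_zero L e dV hdV dW hdW hdV0 hdW0) (gramD_eq_diagonal_cm L e dV hdV dW hdW)
    (J := hermD L e dV hdV dW hdW) rfl (complexConj_imagUnit L) (imagUnit_ne_zero L)

/-- **`ω(archWeilHalf^𝔻 k)` on the doubled Gaussian ⊗ a finite vector, for `k` with unitary phase map**:
`ω(archWeilHalfD k)(G^𝔻 ⊗ f) = vac (sectionD k) • (G^𝔻 ⊗ f)`, `G^𝔻 = follandHermite frameD 0`. [cite: Folland1989, §4.2 Prop. (4.39)] -/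
theorem omega_archWeilHalfD_gaussian_tmul
    (k : UnitaryGroup.arch (Fp L) L (IsCMField.complexConj L) (n + n) (hermD L e dV hdV dW hdW))
    (u : Matrix.unitaryGroup (Fin (n + n) × {v : InfinitePlace (Fp L) // v.IsReal}) ℂ)
    (hu : MpS.proj (sectionD L e dV hdV hdV0 dW hdW hdW0 k) = realifySp _ u)
    (f : FinSB (Fp L) (Fin (n + n))) :
    adelicMpCont.omega (Fp L) (Fin (n + n)) (gramDA L e dV hdV dW hdW) (archWeilHalfD L e dV hdV hdV0 dW hdW hdW0 k)
        (piSchwartzBruhatEquiv (Fp L) (Fin (n + n)) (follandHermite (frameD L e dV hdV hdV0 dW hdW hdW0) 0 ⊗ₜ f)) =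
      MpS.vac (sectionD L e dV hdV hdV0 dW hdW hdW0 k) •
        piSchwartzBruhatEquiv (Fp L) (Fin (n + n)) (follandHermite (frameD L e dV hdV hdV0 dW hdW hdW0) 0 ⊗ₜ f) := by
  unfold archWeilHalfD archWeilHalf follandHermite
  exact omega_archLift_gaussian_tmul _ _ _ _ _ _ _ k u hu f

/-- **`ω(archHalfOf t k)` on the doubled Gaussian ⊗ a finite vector**: the scalar `η_t(k) · vac (sectionD k)` — for a sign-block compact
`k = (k⁺_v, k⁻_v)_v` this is `∏_v det(k_v)^{(t_{w(v)}+1)/2} · (det k⁻_v)⁻¹` (`vac_archWeilSectionS`, `vac_weilHom_kV`), the `K_H`-character of the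
doubled vacuum under THE `χ`-normalised doubled Weil representation (`doubledWeilRep_archToAdelic_eq_archHalfOf`).
[cite: Folland1989, §4.2 Prop. (4.39)] [cite: Paul1998, §1.2 (1.2.1)–(1.2.2)] -/
theorem omega_archHalfOf_gaussian_tmul (t : InfinitePlace L → ℤ)
    (k : UnitaryGroup.arch (Fp L) L (IsCMField.complexConj L) (n + n) (hermD L e dV hdV dW hdW))
    (u : Matrix.unitaryGroup (Fin (n + n) × {v : InfinitePlace (Fp L) // v.IsReal}) ℂ)
    (hu : MpS.proj (sectionD L e dV hdV hdV0 dW hdW hdW0 k) = realifySp _ u)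
    (f : FinSB (Fp L) (Fin (n + n))) :
    adelicMpCont.omega (Fp L) (Fin (n + n)) (gramDA L e dV hdV dW hdW) (archHalfOf L e dV hdV hdV0 dW hdW hdW0 t k)
        (piSchwartzBruhatEquiv (Fp L) (Fin (n + n)) (follandHermite (frameD L e dV hdV hdV0 dW hdW hdW0) 0 ⊗ₜ f)) =
      (((etaD L e dV hdV dW hdW t k : ℂˣ) : ℂ) * MpS.vac (sectionD L e dV hdV hdV0 dW hdW hdW0 k)) •
        piSchwartzBruhatEquiv (Fp L) (Fin (n + n)) (follandHermite (frameD L e dV hdV hdV0 dW hdW hdW0) 0 ⊗ₜ f) := by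
  delta archHalfOf
  rw [adelicMpCont.omega_twist, omega_archWeilHalfD_gaussian_tmul L e dV hdV hdV0 dW hdW hdW0 k u hu f, smul_smul]

end Literature.NumberTheory.GelbartRogawski1991.GRConstruction

end
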